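import Literature.Analysis.FluidPDE.TaoH1LocalExistence
import Literature.Analysis.FluidPDE.NSFourierSobolev
import HarnessLib

/-!
# Tao (2011/2013), Thm. 5.4 (ii)+(iv): decomposition of `tao2011_smooth_local_existence` through
# the Fourier side

First file of the discharge of the named fact
`Literature.Analysis.FluidPDE.tao2011_smooth_local_existence` (`TaoH1LocalExistence.lean`;
T. Tao, *Localisation and compactness properties of the Navier–Stokes global regularity problem*,
Anal. PDE 6 (2013) = arXiv:1108.1165, §5, Thm. 5.4 = arXiv Thm. 31, p. 18, items (i), (ii), (iv)
and the note closing the proof of (iv)): local existence, for `ν > 0` and a smooth divergence-free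
datum `u₀ ∈ H^∞(ℝ³)`, of a classical solution on the closed slab `[0, T] × ℝ³` whenever
`‖u₀‖⁴_{H¹} T ≤ c ν³`, with `u, ∂ₜu, p ∈ L^∞_t H^k_x` and `u ∈ C([0, T]; L²)`.

Tao's proof (arXiv p. 18: "This proceeds by repeating the proof of Theorem 28 verbatim"; proof of
Thm. 28 = journal Thm. 5.1, arXiv p. 16) is a Picard iteration for the Duhamel formula
`u(t) = e^{tΔ}u₀ + ∫₀ᵗ e^{(t-t')Δ} P B(u, u)(t') dt'` in the space
`X¹ = L^∞_t H¹_x ∩ L²_t H²_x`, closed by the energy estimate (energy-duh2) and the bilinear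
estimate (bilinear-2) of his Lemma 2.? (arXiv Lemma 23, p. 10), followed by an induction on `k`
for the `X^k` bounds and, for (iv), Sobolev embedding in the equation. The tree already contains a
complete Fourier-side construction of Leray's local *regular* solution (`NSFourierWeights` → … →
`NSFourierRestart`, `NSFourierSobolev`): the solution is `u(t) = Re 𝓕 v(t)` with `v` the fixed
point of the Fourier-transformed Duhamel map, iterated in *pointwise* weighted sup-norms
`sup_ξ (1 + ‖ξ‖)^K ‖v(t, ξ)‖`. That construction does not prove the present fact, for two reasons:
its lifespan is Picard's time in the pointwise norms (not `c ν³ ‖u₀‖⁻⁴_{H¹}`), and a general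
datum `u₀ ∈ C^∞ ∩ H^∞` (all derivatives in `L²`, no decay beyond `L²` assumed) has a Fourier
transform that is only *weighted square integrable* (`(1 + ‖ξ‖)^k û₀ ∈ L²_ξ` for all `k`), in
general neither bounded nor continuous — so it is not a datum of that pipeline at all.

The discharge therefore reproduces Tao's `X¹` argument on the Fourier side in the
weighted-`L²` class (files `NSFourierL2*`, `TaoH1FourierLocalExistence`, `SobolevFourierDatum`).
This file records the top-level split into two named facts and **proves the assembly**:

* `IsSobolevFourierDatum a` — the Fourier-side datum class: `a : ℝ³_ξ → ℂ³` measurable with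
  `∫ (1 + ‖ξ‖)^{2k} |a(ξ)|² dξ < ∞` for every `k` (i.e. `Re 𝓕 a ∈ H^∞`), the divergence-free
  symbol relation `∑ₗ ξₗ aₗ(ξ) = 0` and the conjugation symmetry `a(-ξ) = conj a(ξ)` (reality of
  `𝓕 a`) — the weighted-`L²` analogue of the tree's `FourierNS.FourierDatum`;
* `tao2011_fourier_local_existence` — **Thm. 5.4 (ii)+(iv) for data given on the Fourier side**:
  the conclusions of `tao2011_smooth_local_existence`, with datum `u(0) = synthVel a = Re 𝓕 a`,
  under `(∫ (1 + 4π²‖ξ‖²) |a|²)² T ≤ c ν³` (the Plancherel form of `‖u₀‖⁴_{H¹} T ≤ c ν³`);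
* `sobolev_fourierDatum_of_smooth` — **Plancherel for `H^∞ ∩ C^∞` fields**: every smooth
  divergence-free `u₀ : ℝ³ → ℝ³` with all derivatives in `L²` is `synthVel a` for an
  `IsSobolevFourierDatum a`, with `∫ (1 + 4π²‖ξ‖²)|a|² = ‖u₀‖²_{L²} + ‖∇u₀‖²_{L²}`
  (Stein–Weiss 1971, Ch. I, Thm. 2.3 (Plancherel) with Thm. 1.8/§1.2 (transform of a derivative));
* `tao2011_smooth_local_existence_of_fourier` — the two facts imply
  `tao2011_smooth_local_existence` (proved here).

Nothing else is asserted. The plan of the remaining files is kept in the discharging agent's notes;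
each of the two facts is discharged separately (`…_holds`).

## Mathlib / tree search

`lean search 'FourierDatum'`: `FourierNS.FourierDatum` (`NSFourierRestart`, pointwise decay of every
order + continuity — not satisfied by general `H^∞` data); `FourierNS.synthVel` (`NSFourierSobolev`,
reused for the synthesis `Re 𝓕 a`); `FourierNS.ClayDatum` (Schwartz data). Mathlib:
`MeasureTheory.Lp.fourierTransformₗᵢ` (the `L²` transform), `TemperedDistribution.MemSobolev`
(Bessel-potential Sobolev spaces) — the fact `sobolev_fourierDatum_of_smooth` is the pointwise
bridge between the classical `H^∞ ∩ C^∞` hypotheses of the target and such `L²` statements; it is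
not in Mathlib (searched `fourier`, `Sobolev`, `iteratedFDeriv` in `Analysis/Distribution`,
`Analysis/Fourier`).

## References

* T. Tao, arXiv:1108.1165 = Anal. PDE 6 (2013): Thm. 5.4 = arXiv Thm. 31 (p. 18) with its proof
  and the note closing it; Thm. 28 and its proof (p. 16); Lemma 23 (p. 10); `X^s` (p. 9).
  [Tao2011]
* E. M. Stein, G. Weiss, *Introduction to Fourier Analysis on Euclidean Spaces*, PUP 1971, Ch. I,
  §1 (Thm. 1.8) and §2 (Thm. 2.3, Plancherel). [SteinWeiss1971]
-/

noncomputable section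

open MeasureTheory Set Function Filter Real Complex FourierTransform
open scoped ENNReal NNReal ContDiff ComplexConjugate FourierTransform
open _root_.Topology

namespace Literature.Analysis.FluidPDE

namespace FourierNS

variable {ι : Type*} [Fintype ι]

/-- **Fourier-side data of Sobolev class `H^∞`.** A coefficient field `a : E → ℂ^ι`
(`E = EuclideanSpace ℝ ι`, frequency space) which is (a.e. strongly) measurable, has finite
weighted square moments `∫ (1 + ‖ξ‖)^{2k} ∑ₗ |aₗ(ξ)|² dξ < ∞` of every order `k` (by Plancherel:
`Re 𝓕 a ∈ H^k` for every `k`), satisfies the divergence-free symbol relation `∑ₗ ξₗ aₗ(ξ) = 0`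
at every frequency and the conjugation symmetry `a(-ξ) = conj a(ξ)` (so that the syntheses
`𝓕 aₗ` are real valued). This is the weighted-`L²` analogue of the tree's pointwise class
`FourierNS.FourierDatum` (which asks continuity and `sup_ξ (1 + ‖ξ‖)^K ‖a(ξ)‖ < ∞`); the Fourier
transform of a general smooth divergence-free `u₀ ∈ H^∞(ℝ³)` is of this class
(`sobolev_fourierDatum_of_smooth`) but in general not of the pointwise one. [folklore] -/
structure IsSobolevFourierDatum (a : EuclideanSpace ℝ ι → ι → ℂ) : Prop where
  /-- measurability of the datum -/
  meas : AEStronglyMeasurable a volume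
  /-- weighted square moments of every order (`Re 𝓕 a ∈ H^k` for all `k`) -/
  moments : ∀ k : ℕ, ∫⁻ ξ, ENNReal.ofReal ((1 + ‖ξ‖) ^ (2 * k)) * ∑ l, ‖a ξ l‖ₑ ^ 2 < ⊤
  /-- the divergence-free symbol relation `∑ₗ ξₗ aₗ(ξ) = 0` -/
  divFree : ∀ ξ, ∑ l, ((ξ l : ℝ) : ℂ) * a ξ l = 0
  /-- conjugation symmetry (reality of the synthesized field) -/
  conjSymm : ∀ ξ l, a (-ξ) l = conj (a ξ l)

omit [Fintype ι] in
/-- The square moment of order `0` is finite: `∑ₗ ∫ |aₗ|² < ∞`. [folklore] -/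
theorem IsSobolevFourierDatum.lintegral_sum_enorm_sq_lt_top [Fintype ι]
    {a : EuclideanSpace ℝ ι → ι → ℂ} (ha : IsSobolevFourierDatum a) :
    ∫⁻ ξ, ∑ l, ‖a ξ l‖ₑ ^ 2 < ⊤ := by
  simpa using ha.moments 0

end FourierNS

open FourierNS

/-- The Fourier-side `H¹` quantity `∫ (1 + 4π²‖ξ‖²) ∑ₗ |aₗ(ξ)|² dξ`, equal by Plancherel to
`‖Re 𝓕 a‖²_{L²} + ‖∇ Re 𝓕 a‖²_{L²}` (Frobenius norm of the gradient) for a conjugation-symmetric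
`a` (`sobolev_fourierDatum_of_smooth`). [folklore] -/
def fourierH1Sq (a : EuclideanSpace ℝ (Fin 3) → Fin 3 → ℂ) : ℝ≥0∞ :=
  ∫⁻ ξ, ENNReal.ofReal (1 + 4 * π ^ 2 * ‖ξ‖ ^ 2) * ∑ l, ‖a ξ l‖ₑ ^ 2

/-- Unfolding `fourierH1Sq`. [folklore] -/
theorem fourierH1Sq_eq (a : EuclideanSpace ℝ (Fin 3) → Fin 3 → ℂ) :
    fourierH1Sq a = ∫⁻ ξ, ENNReal.ofReal (1 + 4 * π ^ 2 * ‖ξ‖ ^ 2) * ∑ l, ‖a ξ l‖ₑ ^ 2 := rfl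

/-- **Tao 2011, Thm. 5.4 (ii)+(iv) (with (i) and the note closing the proof of (iv)), for data
given on the Fourier side.** There is an absolute constant `c > 0` such that: for `ν > 0`, `T > 0`
and a Fourier datum `a : ℝ³ → ℂ³` of Sobolev class (`IsSobolevFourierDatum a`: all weighted square
moments finite, divergence-free symbol relation, conjugation symmetry), if
`(∫ (1 + 4π²‖ξ‖²) |a(ξ)|² dξ)² · T ≤ c ν³` (written with a real `A ≥ 0` dominating the integral;
by Plancherel this is `‖u₀‖⁴_{H¹} T ≤ c ν³` for `u₀ = Re 𝓕 a`, Tao's hypothesis of (ii) with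
`f = 0` after the footnote-3 rescaling to viscosity `ν`), then there is a classical solution
`(u, p)` of the unforced Navier–Stokes system on the closed slab `[0, T] × ℝ³` with
`u(0) = synthVel a = Re 𝓕 a`, with `u, ∂ₜu, p ∈ L^∞_t H^k_x([0, T] × ℝ³)` for every `k` and
`u ∈ C([0, T]; L²)` — the conclusions of `tao2011_smooth_local_existence`. In print (arXiv Thm. 31,
p. 18): "(ii) If `(‖u₀‖_{H¹_x(ℝ³)} + ‖f‖_{L¹_t H¹_x(ℝ³)})⁴ T ≤ c` … then there exists a `H¹` mild
solution … `‖u‖_{X^k([0,T] × ℝ³)} ≲_{k, ‖u₀‖_{H^k_x}, ‖f‖_{L¹_t H^k_x}, 1}` for each `k ≥ 1`. …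
(iv) If … `(u₀, f, T)` is Schwartz, then `u` and `p` are smooth; in fact, one has
`∂ₜʲu, ∂ₜʲp ∈ L^∞_t H^k([0, T] × ℝ³)` for all `j, k ≥ 0`", with the closing note "it would have
sufficed to have `u₀ ∈ H^k_x(ℝ³)` … for all `j, k ≥ 0`"; the proof is the `X¹` Picard iteration of
the proof of Thm. 28 (p. 16) with Lemma 23 (p. 10), which the discharge runs on the Fourier side
(`u = Re 𝓕 v`, `v` the fixed point of the transformed Duhamel map). Rendering: `f = 0`; datum in
`H^∞` given through its transform `a`; the solution produced is the `H¹` mild solution of (ii)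
(normalised pressure), classical on the closed slab by (iv). [cite: Tao2011, Thm. 5.4 (ii)+(iv)] -/
def tao2011_fourier_local_existence : Prop :=
  ∃ c : ℝ, 0 < c ∧ ∀ ⦃ν T : ℝ⦄, 0 < ν → 0 < T →
    ∀ ⦃a : EuclideanSpace ℝ (Fin 3) → Fin 3 → ℂ⦄, IsSobolevFourierDatum a →
      ∀ ⦃A : ℝ⦄, 0 ≤ A → fourierH1Sq a ≤ ENNReal.ofReal A → A ^ 2 * T ≤ c * ν ^ 3 →
        ∃ (u : ℝ → EuclideanSpace ℝ (Fin 3) → EuclideanSpace ℝ (Fin 3))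
          (p : ℝ → EuclideanSpace ℝ (Fin 3) → ℝ),
          FluidPDE.IsClassicalNSSolutionOn (Icc 0 T) ν 0 u p ∧ u 0 = synthVel a ∧
          HasBoundedSobolevNormsOn (Icc 0 T) u ∧
          HasBoundedSobolevNormsOn (Icc 0 T) (FluidPDE.timeDerivWithin (Icc 0 T) u) ∧
          (∀ n : ℕ, ∃ C : ℝ≥0, ∀ t ∈ Icc 0 T, ∫⁻ x, ‖iteratedFDeriv ℝ n (p t) x‖ₑ ^ 2 ≤ C) ∧
          FluidPDE.ContinuousInLpOn (Icc 0 T) 2 u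

/-- **Plancherel for smooth `H^∞` vector fields (Fourier representation of the datum).** Every
smooth divergence-free `u₀ : ℝ³ → ℝ³` with `∫ ‖Dⁿu₀‖² < ∞` for every `n` is the synthesis
`u₀ = synthVel a = Re 𝓕 a` of a Fourier datum of Sobolev class (`IsSobolevFourierDatum a`:
`a = 𝓕⁻¹u₀` componentwise, all weighted square moments finite, `∑ₗ ξₗ aₗ = 0` from `div u₀ = 0`,
`a(-ξ) = conj a(ξ)` from reality), and the `H¹` quantity of the target is the weighted square
moment `‖u₀‖²_{L²} + ‖∇u₀‖²_{L²} = ∫ (1 + 4π²‖ξ‖²) ∑ₗ |aₗ(ξ)|² dξ` (Frobenius norm of `∇u₀`,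
`FluidPDE.frobeniusNormSq`). Sources: Plancherel's theorem `‖𝓕f‖_{L²} = ‖f‖_{L²}` and the
extension of `𝓕` to a unitary map of `L²(ℝⁿ)` (Stein–Weiss 1971, Ch. I, Thm. 2.3), and
`(∂ⱼf)^ (ξ) = 2πi ξⱼ f̂(ξ)` (Stein–Weiss 1971, Ch. I, Thm. 1.8), here for `f ∈ C^∞` with all
derivatives in `L²` (truncation `χ_R f ∈ C_c^∞` and `R → ∞`). Mathlib has the `L²` transform
(`MeasureTheory.Lp.fourierTransformₗᵢ`) and Bessel-potential Sobolev spaces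
(`TemperedDistribution.MemSobolev`) but not this pointwise bridge.
[cite: SteinWeiss1971, Ch. I Thm. 2.3 + Thm. 1.8] -/
def sobolev_fourierDatum_of_smooth : Prop :=
  ∀ ⦃u₀ : EuclideanSpace ℝ (Fin 3) → EuclideanSpace ℝ (Fin 3)⦄,
    ContDiff ℝ ∞ u₀ → VectorCalculus.IsDivFree u₀ →
    (∀ n : ℕ, ∫⁻ x, ‖iteratedFDeriv ℝ n u₀ x‖ₑ ^ 2 < ⊤) →
    ∃ a : EuclideanSpace ℝ (Fin 3) → Fin 3 → ℂ, IsSobolevFourierDatum a ∧ synthVel a = u₀ ∧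
      fourierH1Sq a =
        (∫⁻ x, ‖u₀ x‖ₑ ^ 2) + ∫⁻ x, ENNReal.ofReal (FluidPDE.frobeniusNormSq (fderiv ℝ u₀ x))

/-- **Assembly (proved): Thm. 5.4 (ii)+(iv) on the Fourier side + Plancherel for the datum ⇒
`tao2011_smooth_local_existence`.** Given the physical datum `u₀ ∈ C^∞ ∩ H^∞`, divergence free,
write `u₀ = synthVel a` (`sobolev_fourierDatum_of_smooth`); the `H¹` hypothesis
`‖u₀‖²_{L²} + ‖∇u₀‖²_{L²} ≤ A` is `fourierH1Sq a ≤ A`, so `tao2011_fourier_local_existence`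
with the same constant `c` produces the classical solution with `u(0) = synthVel a = u₀` and all the
required bounds. [cite: Tao2011, Thm. 5.4 (ii)+(iv)] -/
theorem tao2011_smooth_local_existence_of_fourier (hF : tao2011_fourier_local_existence)
    (hP : sobolev_fourierDatum_of_smooth) : tao2011_smooth_local_existence := by
  obtain ⟨c, hc, hloc⟩ := hF
  refine ⟨c, hc, fun ν T hν hT u₀ hsm hdiv hHinf A hA hH1 hcT => ?_⟩
  obtain ⟨a, ha, hsynth, hPl⟩ := hP hsm hdiv hHinf
  have hH1' : fourierH1Sq a ≤ ENNReal.ofReal A := hPl ▸ hH1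
  obtain ⟨u, p, hsol, hu0, hub, hutb, hpb, huc⟩ := hloc hν hT ha hA hH1' hcT
  exact ⟨u, p, hsol, hu0.trans hsynth, hub, hutb, hpb, huc⟩

end Literature.Analysis.FluidPDE

end
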